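import Summits.BirchSwinnertonDyer.BirchSwinnertonDyer.Theorems.ResidualThetaTransportAtTwoSignedMuVanishingAtTwoPlusCuspSpanFlat
import HarnessLib

/-!
# Route `ThetaPartnerAtTwo` (TP2), crux K2r0 `SignedMainConjectureCMTwoRankZero` (stmt-BirchSwinnertonDyer-20312), line
# `rankzero` v12: the analytic research stub (μ♭)_A follows from the CURVE-FREE per-level statement (G′)_{N_A} of the
# RTT Kμ⁺ seats — one node serves both cruxes

HONEST FRAMING (cell `pub/bsd-wall`, W-ALL row 1, lead prover `bsd-wall-tp2-p2` g5). Nothing here is the crux and nothing is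
asserted about any curve. The K2r0 line `rankzero` carries the research binder (μ♭)_A: «for every CM curve `A/ℚ` of analytic
rank `0`, good supersingular at `2`, `a₂ = 0`, off the unit zone, Kobayashi's `L⁺ = L♭` of the newform of `A` at `2` has a unit
coefficient». The RTT seats (crux Kμ⁺ stmt-BirchSwinnertonDyer-20689, child 21437; lead rtt-p4 g4/g5, width w3 g2) reduced the same
question for non-CM curves to a curve-free, finite, exactly certifiable statement per LEVEL — (G′)_N: every additive
`χ : Γ₀(N) → 𝔽₂` factoring through the period functional and killing every `γ` with lower-left entry of absolute value `4^k`
(`k ≥ 1`) factors through `γ ↦ d(γ) mod N` — and landed `SignedMuAtTwo.flatAtTwo_of_cuspSpan` (p593268): (G′)_{N_W} ⟹ `2 ∤ L♭` for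
every Pollack pair at `2` of the newform of ANY globally minimal `W` with `GoodSS W 2`, `a₂ = 0` (no CM / rank / discriminant
hypothesis). THIS FILE reads that theorem for the CM partner: §1 `exists_isUnit_coeff_of_not_C_two_dvd` (`2 ∤ L` ⟺ a unit
coefficient, the currency of the K2r0 stub); §2 `analyticMuFlatCMTwo_at_of_cuspSpan` ((G′)_{N_A} ⟹ (μ♭) AT `A`, any `A` good
supersingular at `2` with `a₂ = 0`) and `analyticMuFlatNonUnitCMTwo_of_cuspSpan` / `…_of_cuspSpan_all` (the registered stub
`stub_analyticMuFlatNonUnitCMTwo` VERBATIM from (G′) at the conductors of the CM row, resp. from (G′) at every odd level). So the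
analytic residue of K2r0 is the RTT node (G′)_N read at the levels `N_A` (`= 27·D², 121·D², 361·D², 1849·D², 4489·D², 26569·D², …`);
(G′)_N is verified exactly for all odd `N ≤ 2999` by the RTT lead (evidence on 20689) and is OPEN class-wide. BSD is not proved by
any of this.

References: [Pollack2003] Prop. 6.18, Conj. 6.3; [Kobayashi2003] Thm. 1.2; [MazurTateTeitelbaum1986Invent] §I.4, §I.8; [Manin1972]
(Manin symbols); RTT workfile `Cruxes/SignedMuVanishingAtTwoPlus/FlatCuspSpan.md`.
-/

set_option autoImplicit false
-- the Theorems namespace of this sub repeats the summit name by design (D-0017 nested layout)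
set_option linter.dupNamespace false

noncomputable section

open scoped Classical MatrixGroups ModularForm

open CongruenceSubgroup WeierstrassCurve Literature.NumberTheory.EllipticCurves
  Literature.NumberTheory.EllipticCurves.ModularForms Literature.NumberTheory.EllipticCurves.Rank1Residual
  Summit.BirchSwinnertonDyer.Rank1Residual.Supersingular

namespace Summit.BirchSwinnertonDyer.BirchSwinnertonDyer.Theorems

/-! ## §1. `2 ∤ L` in `ℤ₂⟦T⟧` ⟺ some coefficient is a unit -/

/-- In `Λ = ℤ₂⟦T⟧`: if `2 ∤ L` then some coefficient of `L` is a unit (the non-units of `ℤ₂` are `2ℤ₂`). [folklore] -/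
theorem exists_isUnit_coeff_of_not_C_two_dvd {L : IwasawaAlgebra 2} (h : ¬ PowerSeries.C (2 : ℤ_[2]) ∣ L) :
    ∃ n : ℕ, IsUnit (PowerSeries.coeff n L) := by
  by_contra hno
  have hno' : ∀ n : ℕ, ¬ IsUnit (PowerSeries.coeff n L) := fun n hn ↦ hno ⟨n, hn⟩
  apply h
  have hc : ∀ n : ℕ, ∃ c : ℤ_[2], PowerSeries.coeff n L = 2 * c := by
    intro n
    have hmem : PowerSeries.coeff n L ∈ IsLocalRing.maximalIdeal ℤ_[2] := hno' n
    rw [PadicInt.maximalIdeal_eq_span_p, Ideal.mem_span_singleton] at hmem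
    obtain ⟨c, hc⟩ := hmem
    exact ⟨c, by rw [hc]; norm_num⟩
  choose c hc using hc
  refine ⟨PowerSeries.mk c, PowerSeries.ext fun n ↦ ?_⟩
  rw [PowerSeries.coeff_C_mul, PowerSeries.coeff_mk, hc n]

/-- `kobayashiL 1 L⁺ L⁻ = L⁻` (Kobayashi's `L_p^+` is the tree's `Lminus`). [cite: Kobayashi2003, (3.6) (p. 7)] -/
theorem kobayashiL_one {p : ℕ} [Fact p.Prime] (Lplus Lminus : IwasawaAlgebra p) : kobayashiL 1 Lplus Lminus = Lminus := by
  simp [kobayashiL]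

/-! ## §2. (G′)_{N_A} ⟹ (μ♭) at `A`; the registered stub from (G′) -/

/-- **(G′)_{N_A} ⟹ (μ♭) AT `A`.** For `A/ℚ` globally minimal, good supersingular at `2` with `a₂ = 0` (no CM, rank or zone
hypothesis): if the dual cusp-span statement (G′) holds at level `N_A`, then for every newform `f` of `A` and every Pollack pair
`(L⁺, L⁻)` of `f` at `2`, Kobayashi's `L⁺ = kobayashiL 1 L⁺ L⁻ = L♭` has a unit coefficient (RTT `SignedMuAtTwo.flatAtTwo_of_cuspSpan`
+ §1). [cite: Pollack2003, Prop. 6.18] [cite: MazurTateTeitelbaum1986Invent, §I.8] -/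
theorem analyticMuFlatCMTwo_at_of_cuspSpan (A : WeierstrassCurve ℚ) [A.IsElliptic] [A.IsGloballyMinimal]
    (hss : GoodSS A 2) (ha : A.frobeniusTrace 2 = 0) [NeZero (A.conductorNorm ℤ)]
    (hG : ∀ χ : Gamma0 (A.conductorNorm ℤ) → ZMod 2,
      (∀ γ δ : Gamma0 (A.conductorNorm ℤ), χ (γ * δ) = χ γ + χ δ) →
      (∀ γ δ : Gamma0 (A.conductorNorm ℤ),
        periodFunctional (A.conductorNorm ℤ) γ = periodFunctional (A.conductorNorm ℤ) δ → χ γ = χ δ) →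
      (∀ γ : Gamma0 (A.conductorNorm ℤ), (∃ k : ℕ, 1 ≤ k ∧ ((γ : SL(2, ℤ)) 1 1).natAbs = 4 ^ k) → χ γ = 0) →
      ∃ ψ : ZMod (A.conductorNorm ℤ) → ZMod 2,
        (∀ x y : ZMod (A.conductorNorm ℤ), IsUnit x → IsUnit y → ψ (x * y) = ψ x + ψ y) ∧
        ∀ γ : Gamma0 (A.conductorNorm ℤ), χ γ = ψ ((((γ : SL(2, ℤ)) 1 1 : ℤ) : ZMod (A.conductorNorm ℤ))))
    (f : CuspForm (Gamma0 (A.conductorNorm ℤ)) 2) (hf : IsNewformOf A f)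
    (Lplus Lminus : IwasawaAlgebra 2) (hPP : IsPollackPair f 2 Lplus Lminus) :
    ∃ n : ℕ, IsUnit (PowerSeries.coeff n (kobayashiL 1 Lplus Lminus)) := by
  rw [kobayashiL_one]
  exact exists_isUnit_coeff_of_not_C_two_dvd (SignedMuAtTwo.flatAtTwo_of_cuspSpan hf hss ha hG Lplus Lminus hPP)

/-- **The registered stub `stub_analyticMuFlatNonUnitCMTwo` of line `rankzero` (K2r0, stmt-BirchSwinnertonDyer-20312), VERBATIM,
from (G′) at the conductors of the CM row** (the CM / rank / zone binders are carried, not used). [cite: Pollack2003, Prop. 6.18] -/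
theorem analyticMuFlatNonUnitCMTwo_of_cuspSpan
    (hG : ∀ (A : WeierstrassCurve ℚ) [A.IsElliptic] [A.IsGloballyMinimal],
      A.HasCM → A.analyticRank = 0 → GoodSS A 2 → A.frobeniusTrace 2 = 0 → 2 ∣ A.shaOrder * A.tamagawaProduct →
      ∀ [NeZero (A.conductorNorm ℤ)], ∀ χ : Gamma0 (A.conductorNorm ℤ) → ZMod 2,
      (∀ γ δ : Gamma0 (A.conductorNorm ℤ), χ (γ * δ) = χ γ + χ δ) →
      (∀ γ δ : Gamma0 (A.conductorNorm ℤ),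
        periodFunctional (A.conductorNorm ℤ) γ = periodFunctional (A.conductorNorm ℤ) δ → χ γ = χ δ) →
      (∀ γ : Gamma0 (A.conductorNorm ℤ), (∃ k : ℕ, 1 ≤ k ∧ ((γ : SL(2, ℤ)) 1 1).natAbs = 4 ^ k) → χ γ = 0) →
      ∃ ψ : ZMod (A.conductorNorm ℤ) → ZMod 2,
        (∀ x y : ZMod (A.conductorNorm ℤ), IsUnit x → IsUnit y → ψ (x * y) = ψ x + ψ y) ∧
        ∀ γ : Gamma0 (A.conductorNorm ℤ), χ γ = ψ ((((γ : SL(2, ℤ)) 1 1 : ℤ) : ZMod (A.conductorNorm ℤ)))) :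
    ∀ (A : WeierstrassCurve ℚ) [A.IsElliptic] [A.IsGloballyMinimal],
      A.HasCM → A.analyticRank = 0 → GoodSS A 2 → A.frobeniusTrace 2 = 0 →
      2 ∣ A.shaOrder * A.tamagawaProduct →
      ∀ [NeZero (A.conductorNorm ℤ)] (f : CuspForm (Gamma0 (A.conductorNorm ℤ)) 2),
      IsNewformOf A f → ∀ (Lplus Lminus : IwasawaAlgebra 2), IsPollackPair f 2 Lplus Lminus →
        ∃ n : ℕ, IsUnit (PowerSeries.coeff n (kobayashiL 1 Lplus Lminus)) :=
  fun A _ _ hcm hr hss ha hz _ f hf Lplus Lminus hPP ↦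
    analyticMuFlatCMTwo_at_of_cuspSpan A hss ha (hG A hcm hr hss ha hz) f hf Lplus Lminus hPP

/-- **The registered stub `stub_analyticMuFlatNonUnitCMTwo` from (G′)_N at EVERY odd level** (the hypothesis `hG` of RTT's
`SignedMuAtTwo.flatMuZeroAtTwo_of_cuspSpan`, verbatim): the SAME curve-free node closes the analytic residue of K2r0 (CM partner) and
of Kμ⁺ child 21437 (non-CM habitat⁺). `2 ∤ N_A` by good reduction at `2`. [cite: Pollack2003, Prop. 6.18 and Conj. 6.3] -/
theorem analyticMuFlatNonUnitCMTwo_of_cuspSpan_all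
    (hG : ∀ (N : ℕ) [NeZero N], ¬ 2 ∣ N → ∀ χ : Gamma0 N → ZMod 2,
      (∀ γ δ : Gamma0 N, χ (γ * δ) = χ γ + χ δ) →
      (∀ γ δ : Gamma0 N, periodFunctional N γ = periodFunctional N δ → χ γ = χ δ) →
      (∀ γ : Gamma0 N, (∃ k : ℕ, 1 ≤ k ∧ ((γ : SL(2, ℤ)) 1 1).natAbs = 4 ^ k) → χ γ = 0) →
      ∃ ψ : ZMod N → ZMod 2, (∀ x y : ZMod N, IsUnit x → IsUnit y → ψ (x * y) = ψ x + ψ y) ∧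
        ∀ γ : Gamma0 N, χ γ = ψ ((((γ : SL(2, ℤ)) 1 1 : ℤ) : ZMod N))) :
    ∀ (A : WeierstrassCurve ℚ) [A.IsElliptic] [A.IsGloballyMinimal],
      A.HasCM → A.analyticRank = 0 → GoodSS A 2 → A.frobeniusTrace 2 = 0 →
      2 ∣ A.shaOrder * A.tamagawaProduct →
      ∀ [NeZero (A.conductorNorm ℤ)] (f : CuspForm (Gamma0 (A.conductorNorm ℤ)) 2),
      IsNewformOf A f → ∀ (Lplus Lminus : IwasawaAlgebra 2), IsPollackPair f 2 Lplus Lminus →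
        ∃ n : ℕ, IsUnit (PowerSeries.coeff n (kobayashiL 1 Lplus Lminus)) :=
  fun A _ _ _ _ hss ha _ _ f hf Lplus Lminus hPP ↦
    analyticMuFlatCMTwo_at_of_cuspSpan A hss ha
      (hG (A.conductorNorm ℤ) (SignedMuAtTwo.not_two_dvd_conductorNorm_of_goodSS hss)) f hf Lplus Lminus hPP

end Summit.BirchSwinnertonDyer.BirchSwinnertonDyer.Theorems

end
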